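import Literature.Geometry.Kaehler.KaehlerOsculatingTestFormsProofs
import Literature.Geometry.Kaehler.HodgeStarNaturalityProofs
import Literature.NumberTheory.Transcendental.KaehlerIdentityLocalityProofs

/-!
# Osculating test forms: exchange with `L` and `⋆`, and vanishing of `P = [∂̄*, L] - i∂` at the centre

Sequel to `KaehlerOsculatingTestFormsProofs.lean` (same notation: chart `e` at `x₀`, coordinate
metric `Ĝ`, Riesz map `S` of `G x₀`, Koszul map `B`, frame `M_f`, `U_{y'} = M_f (e y') ∘ De_{y'}`,
test forms `Θ_{f,η}(y') = f y' • η ∘ U_{y'}^{⊗k}`). At points `y'` where `M_f (e y')` is an isometry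
`Ĝ (e y') → G x₀` and `ℂ`-linear (true near `x₀`: `eventually_frameM_isometry`,
`eventually_frameM_comm`):

* `testFrame_isometry`: `G x₀ (U a) (U b) = G y' a b` — `U_{y'} : T_{y'} M → T_{x₀} M` is an
  isometry of tangent spaces; `testFrame_I_smul`: it is `ℂ`-linear;
* **exchange with the Lefschetz operator** `lform_testForm`: `L (Θ_{f,η}) = Θ_{f, L₀ η}` at `y'`
  (`L₀ = ω_{x₀} ∧ ·`; naturality `lef_compContinuousLinearMap`);
* **exchange with the Hodge star** `cHodgeStar_testForm`: `⋆ (Θ_{f,η}) = Θ_{f, ⋆₀ η}` at `y'`, given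
  that the orientation `o y'` is carried to `o x₀` by `U` (`hodgeStar_comp_eq_ite_smul`);
  `eventually_orientation_testFrame`: this holds near `x₀` for an orientation family with continuous
  volume form (the volume forms of `o y'` and of `U^* o x₀` agree up to sign and both tend to
  `vol_{x₀}`);
* **`P Θ = 0` at the centre** (`kaehlerP_testForm_apply_eq_zero`, `…_zero`): by locality, the
  exchange rules and `testForm_typeComponent`, every `d((⋆ L Θ)^{p,q})`, `d((⋆ Θ)^{p,q})`,
  `d(Θ^{p,q})` at `x₀` is `dΘ_{f,η'}(x₀) = 0` for some `η'` (`mextDeriv_testForm_eq_zero`), so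
  `∂̄*(LΘ)(x₀) = 0`, `∂̄*Θ (x₀) = 0`, `∂Θ(x₀) = 0` (`dolbeaultBarAdjoint_apply_eq_zero`,
  `dolbeault_apply_eq_zero`).

Voisin (2002), §6.1.1, proof of Prop. 6.5 via Prop. 3.14.

## References

* C. Voisin, *Hodge Theory and Complex Algebraic Geometry I* (2002), Prop. 3.14, §6.1.1 Prop. 6.5,
  Lemma 6.6. [Voisin2002]
* F. W. Warner, *Foundations of Differentiable Manifolds and Lie Groups* (1983), Ch. 2 Ex. 13.
  [WarnerGTM94]
-/

noncomputable section

open scoped Manifold ContDiff Topology RealInnerProductSpace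
open Set Function Bundle Module Filter ContinuousAlternatingMap
open Literature.Analysis.OperatorTheory Literature.Analysis.Complex Literature.LinearAlgebra.Alternating
open Literature.NumberTheory.Transcendental

namespace Literature.Geometry.Kaehler

set_option quotPrecheck false

section Exchange

variable {E : Type*} [NormedAddCommGroup E] [NormedSpace ℂ E] [CompleteSpace E]
  {M : Type*} [TopologicalSpace M] [ChartedSpace E M] [IsManifold 𝓘(ℝ, E) ∞ M]
  (G : M → E →L[ℝ] E →L[ℝ] ℝ) (S : (E →L[ℝ] ℝ) →L[ℝ] E) (B : E →L[ℝ] E →L[ℝ] E) (x₀ : M)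
  {k : ℕ}

set_option hygiene false in
/-- The chart at `x₀`. -/
local notation "e₀" => extChartAt 𝓘(ℝ, E) x₀

set_option hygiene false in
/-- Its centre. -/
local notation "c₀" => extChartAt 𝓘(ℝ, E) x₀ x₀

set_option hygiene false in
/-- The derivative of the inverse chart at `y`. -/
local notation "Sc[" y "]" => tangentCoordChange 𝓘(ℝ, E) x₀
  ((extChartAt 𝓘(ℝ, E) x₀).symm y) ((extChartAt 𝓘(ℝ, E) x₀).symm y)

set_option hygiene false in
/-- The coordinate metric. -/
local notation "Ĝ[" y "]" => ContinuousLinearMap.bilinearComp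
  (G ((extChartAt 𝓘(ℝ, E) x₀).symm y)) (Sc[y]) (Sc[y])

set_option hygiene false in
/-- `A y⁻¹`. -/
local notation "Ai[" y "]" => Ring.inverse ((1 : E →L[ℝ] E) + B (y - c₀))

set_option hygiene false in
/-- The Gram operator of the transported metric. -/
local notation "Q[" y "]" => ContinuousLinearMap.comp S
  (ContinuousLinearMap.bilinearComp (Ĝ[y]) (Ai[y]) (Ai[y]))

set_option hygiene false in
/-- The square root near `1`. -/
local notation "√₁" => HasStrictFDerivAt.localInverse (fun X : E →L[ℝ] E ↦ X * X)
  (ContinuousLinearEquiv.smulLeft (Units.mk0 (2 : ℝ) two_ne_zero) : (E →L[ℝ] E) ≃L[ℝ] (E →L[ℝ] E))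
  1 hasStrictFDerivAt_mul_self_one

set_option hygiene false in
/-- The osculating unitary frame `M_f y = √(Q y) ∘ A y`. -/
local notation "Mf[" y "]" => (√₁ (Q[y]) * ((1 : E →L[ℝ] E) + B (y - c₀)))

set_option hygiene false in
/-- The frame map on the manifold `U_{y'} = M_f (e y') ∘ De_{y'}`. -/
local notation "U[" y' "]" => ContinuousLinearMap.comp (Mf[extChartAt 𝓘(ℝ, E) x₀ y'])
  (mfderiv 𝓘(ℝ, E) 𝓘(ℝ, E) (extChartAt 𝓘(ℝ, E) x₀) y')

set_option hygiene false in
/-- The test form `Θ_{f,η}`. -/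
local notation "Θ[" f ", " η "]" =>
  (fun y' : M ↦ (f y' : ℝ) • ContinuousAlternatingMap.compContinuousLinearMap η (U[y']))

set_option hygiene false in
/-- The covector family of the model Lefschetz operator. -/
local notation "θE[" B' "]" => (2⁻¹ : ℝ) • ContinuousLinearMap.comp B'
  ((Complex.I • ContinuousLinearMap.id ℂ E).restrictScalars ℝ)

set_option hygiene false in
/-- The canonical family of the model Lefschetz operator. -/
local notation "LfamE[" B' "]" η:max =>
  ContinuousLinearMap.comp (ContinuousAlternatingMap.alternatizeUncurryFinCLM ℝ E ℂ)
    (ContinuousLinearMap.comp (ContinuousLinearMap.flip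
      (ContinuousLinearMap.smulRightL ℝ E (E [⋀^Fin _]→L[ℝ] ℂ)) η) (θE[B']))

set_option hygiene false in
/-- The model Lefschetz operator. -/
local notation "LopE[" B' "]" η:max =>
  ContinuousAlternatingMap.alternatizeUncurryFin (𝕜 := ℝ) (E := E) (F := ℂ) (LfamE[B'] η)

set_option hygiene false in
/-- The Lefschetz operator on forms on `M`. -/
local notation "Lform[" G' "]" β:max =>
  @id (MForm 𝓘(ℝ, E) M ℂ (_ + 1 + 1)) (fun x ↦ (LopE[G' x] (β x) :))

/-- The complexified Hodge star at a point. -/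
local notation "⋆ℂ[" o ", " h "]" η:max =>
  ContinuousLinearMap.compContinuousAlternatingMap Complex.ofRealCLM
      (hodgeStar o h (ContinuousLinearMap.compContinuousAlternatingMap Complex.reCLM η)) +
    Complex.I • ContinuousLinearMap.compContinuousAlternatingMap Complex.ofRealCLM
      (hodgeStar o h (ContinuousLinearMap.compContinuousAlternatingMap Complex.imCLM η))

/-! #### The frame `U_{y'}` is a `ℂ`-linear isometry `T_{y'} M → T_{x₀} M` -/

/-- **`U_{y'}` is an isometry**: `G x₀ (U a) (U b) = G y' a b`, at a point `y'` of the chart source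
where `M_f (e y')` is an isometry `Ĝ (e y') → G x₀` (`hiso`, `eventually_frameM_isometry`).
[cite: Voisin2002, Prop. 3.14] -/
theorem testFrame_isometry {y' : M} (hy' : y' ∈ (e₀).source)
    (hiso : ∀ a b, G x₀ (Mf[e₀ y'] a) (Mf[e₀ y'] b) = Ĝ[e₀ y'] a b)
    (a b : TangentSpace 𝓘(ℝ, E) y') : G x₀ (U[y'] a) (U[y'] b) = G y' a b :=
  calc G x₀ (U[y'] a) (U[y'] b)
      = Ĝ[e₀ y'] (mfderiv 𝓘(ℝ, E) 𝓘(ℝ, E) (e₀) y' a) (mfderiv 𝓘(ℝ, E) 𝓘(ℝ, E) (e₀) y' b) :=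
        hiso _ _
    _ = G ((e₀).symm (e₀ y')) a b :=
        congrArg₂ (fun p q : E ↦ G ((e₀).symm (e₀ y')) p q) (symmDeriv_apply_chartDeriv x₀ hy' a)
          (symmDeriv_apply_chartDeriv x₀ hy' b)
    _ = G y' a b := by rw [(e₀).left_inv hy']

/-- **`U_{y'}` is `ℂ`-linear** when `M_f (e y')` commutes with `i` (`hM`, `eventually_frameM_comm`).
[cite: Voisin2002, Prop. 3.14] -/
theorem testFrame_I_smul [IsManifold 𝓘(ℂ, E) ω M] {y' : M} (hy' : y' ∈ (e₀).source)
    (hM : Mf[e₀ y'] * ((Complex.I • ContinuousLinearMap.id ℂ E).restrictScalars ℝ) =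
      ((Complex.I • ContinuousLinearMap.id ℂ E).restrictScalars ℝ) * Mf[e₀ y'])
    (w : TangentSpace 𝓘(ℝ, E) y') :
    U[y'] (HSMul.hSMul (β := E) (γ := E) Complex.I w) =
      HSMul.hSMul (β := E) (γ := E) Complex.I (U[y'] w) :=
  (congrArg (Mf[e₀ y']) (chartDeriv_I_smul x₀ hy' w)).trans
    (congrArg (fun T : E →L[ℝ] E ↦ T (mfderiv 𝓘(ℝ, E) 𝓘(ℝ, E) (e₀) y' w)) hM)

/-! #### Exchange with the Lefschetz operator -/

/-- **`L Θ_{f,η} = Θ_{f, L₀ η}`** at a point `y'` where `U_{y'}` is a `ℂ`-linear isometry: the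
Lefschetz operator of the metric at `y'` pulls back under `U_{y'}` to the Lefschetz operator `L₀` of
the metric at `x₀` (`lef_compContinuousLinearMap`: the covector families `½ G y' (i·, ·)` and
`½ G x₀ (i U·, U·)` agree). [cite: Voisin2002, §6.1.1 Prop. 6.5] -/
theorem lform_testForm [IsManifold 𝓘(ℂ, E) ω M] (f : M → ℝ) (η : E [⋀^Fin k]→L[ℝ] ℂ) {y' : M}
    (hy' : y' ∈ (e₀).source)
    (hiso : ∀ a b, G x₀ (Mf[e₀ y'] a) (Mf[e₀ y'] b) = Ĝ[e₀ y'] a b)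
    (hM : Mf[e₀ y'] * ((Complex.I • ContinuousLinearMap.id ℂ E).restrictScalars ℝ) =
      ((Complex.I • ContinuousLinearMap.id ℂ E).restrictScalars ℝ) * Mf[e₀ y']) :
    (Lform[G] Θ[f, η]) y' = (Θ[f, LopE[G x₀] η]) y' := by
  have hθ : ∀ w u : E, (θE[G y']) w u = (θE[G x₀]) (U[y'] w) (U[y'] u) := fun w u ↦ by
    rw [θE_apply, θE_apply]
    congr 1
    exact ((testFrame_isometry G S B x₀ hy' hiso (HSMul.hSMul (β := E) (γ := E) Complex.I w)
      u).symm).trans (congrArg (fun p : E ↦ G x₀ p (U[y'] u)) (testFrame_I_smul G S B x₀ hy' hM w))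
  have h := lef_compContinuousLinearMap (V := E) (W := E) (θE[G x₀]) η (U[y']) (θE[G y']) hθ
  exact (lopE_real_smul (G y') (f y') (η.compContinuousLinearMap (U[y']))).trans
    (congrArg (fun ξ : E [⋀^Fin (k + 1 + 1)]→L[ℝ] ℂ ↦ f y' • ξ) h)

/-! #### Exchange with the Hodge star -/

variable [FiniteDimensional ℂ E] {n : ℕ} [Fact (finrank ℝ E = n)]
  [RiemannianBundle (fun x : M ↦ TangentSpace 𝓘(ℝ, E) x)]
  (o : (x : M) → Orientation ℝ (TangentSpace 𝓘(ℝ, E) x) (Fin n))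

/-- **`U_{y'}` as a linear isometric isomorphism of tangent spaces** `T_{y'} M ≃ T_{x₀} M`, at a point
where `M_f (e y')` is an isometry (`hiso`), for the metric `G x v w = ⟪v, w⟫ₓ`. [folklore] -/
theorem exists_linearIsometryEquiv_testFrame
    (hG : ∀ (x : M) (v w : TangentSpace 𝓘(ℝ, E) x), G x v w = ⟪v, w⟫) {y' : M}
    (hy' : y' ∈ (e₀).source) (hiso : ∀ a b, G x₀ (Mf[e₀ y'] a) (Mf[e₀ y'] b) = Ĝ[e₀ y'] a b) :
    ∃ φ : TangentSpace 𝓘(ℝ, E) y' ≃ₗᵢ[ℝ] TangentSpace 𝓘(ℝ, E) x₀,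
      ∀ v, φ v = U[y'] v := by
  have hinner : ∀ a b : TangentSpace 𝓘(ℝ, E) y',
      @inner ℝ (TangentSpace 𝓘(ℝ, E) x₀) _ ((U[y']).toLinearMap a) ((U[y']).toLinearMap b) =
        ⟪a, b⟫ := by
    intro a b
    rw [← hG x₀, ← hG y']
    exact testFrame_isometry G S B x₀ hy' hiso a b
  let li : TangentSpace 𝓘(ℝ, E) y' →ₗᵢ[ℝ] TangentSpace 𝓘(ℝ, E) x₀ :=
    LinearMap.isometryOfInner
      ((U[y']).toLinearMap : TangentSpace 𝓘(ℝ, E) y' →ₗ[ℝ] TangentSpace 𝓘(ℝ, E) x₀) hinner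
  have hrk : finrank ℝ (TangentSpace 𝓘(ℝ, E) y') = finrank ℝ (TangentSpace 𝓘(ℝ, E) x₀) := rfl
  exact ⟨li.toLinearIsometryEquiv hrk, fun v ↦ rfl⟩

omit [FiniteDimensional ℂ E] in
/-- Pull-back under `U` written with the isometry `φ` or with `U` is the same. [folklore] -/
theorem compContinuousLinearMap_testFrame_eq {y' : M}
    (φ : TangentSpace 𝓘(ℝ, E) y' ≃ₗᵢ[ℝ] TangentSpace 𝓘(ℝ, E) x₀) (hφ : ∀ v, φ v = U[y'] v)
    {F : Type*} [NormedAddCommGroup F] [NormedSpace ℝ F] {j : ℕ}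
    (β : TangentSpace 𝓘(ℝ, E) x₀ [⋀^Fin j]→L[ℝ] F) :
    β.compContinuousLinearMap
        (φ : TangentSpace 𝓘(ℝ, E) y' →L[ℝ] TangentSpace 𝓘(ℝ, E) x₀) =
      β.compContinuousLinearMap (U[y']) := by
  ext v
  simp only [compContinuousLinearMap_apply]
  congr 1
  funext i
  exact hφ (v i)

/-- **`⋆ Θ_{f,η} = Θ_{f, ⋆₀ η}`** at a point `y'` where `U_{y'}` is an isometry carrying the
orientation `o y'` to `o x₀` (`hor`): naturality of the Hodge star under oriented isometries
(`hodgeStar_comp_eq_ite_smul` with sign `+1`), applied to the real and imaginary parts; the real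
factor `f y'` commutes with `⋆`. [cite: WarnerGTM94, Ch. 2 Ex. 13; Voisin2002, §6.1.1 Prop. 6.5] -/
theorem cHodgeStar_testForm {m : ℕ} (h : k + m = n) (f : M → ℝ) (η : E [⋀^Fin k]→L[ℝ] ℂ) {y' : M}
    (φ : TangentSpace 𝓘(ℝ, E) y' ≃ₗᵢ[ℝ] TangentSpace 𝓘(ℝ, E) x₀) (hφ : ∀ v, φ v = U[y'] v)
    (hor : o x₀ = Orientation.map (Fin n) φ.toLinearEquiv (o y')) :
    MForm.cHodgeStar o h (Θ[f, η]) y' = (Θ[f, ⋆ℂ[o x₀, h] η]) y' := by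
  -- real naturality with sign `+1`
  have hnat : ∀ β : E [⋀^Fin k]→L[ℝ] ℝ,
      hodgeStar (o y') h (β.compContinuousLinearMap (U[y'])) =
        (hodgeStar (o x₀) h β).compContinuousLinearMap (U[y']) := by
    intro β
    have h1 := hodgeStar_comp_eq_ite_smul (o y') (o x₀) φ h β
    rw [if_pos hor, one_smul, compContinuousLinearMap_testFrame_eq G S B x₀ φ hφ,
      compContinuousLinearMap_testFrame_eq G S B x₀ φ hφ] at h1
    exact h1.symm
  -- real and imaginary parts of the pulled-back form
  have hre : ContinuousLinearMap.compContinuousAlternatingMap Complex.reCLM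
      (η.compContinuousLinearMap (U[y'])) =
        (ContinuousLinearMap.compContinuousAlternatingMap Complex.reCLM η).compContinuousLinearMap
          (U[y']) := by
    ext v; rfl
  have him : ContinuousLinearMap.compContinuousAlternatingMap Complex.imCLM
      (η.compContinuousLinearMap (U[y'])) =
        (ContinuousLinearMap.compContinuousAlternatingMap Complex.imCLM η).compContinuousLinearMap
          (U[y']) := by
    ext v; rfl
  have hof : ∀ γ : TangentSpace 𝓘(ℝ, E) x₀ [⋀^Fin m]→L[ℝ] ℝ,
      ContinuousLinearMap.compContinuousAlternatingMap Complex.ofRealCLM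
      (γ.compContinuousLinearMap (U[y'])) =
        (ContinuousLinearMap.compContinuousAlternatingMap Complex.ofRealCLM γ).compContinuousLinearMap
          (U[y']) := fun γ ↦ by
    ext v; rfl
  rw [cHodgeStar_apply_pt]
  change ⋆ℂ[o y', h] (f y' • η.compContinuousLinearMap (U[y'])) =
    f y' • (⋆ℂ[o x₀, h] η).compContinuousLinearMap (U[y'])
  rw [cHodgeStarPt_real_smul o h y' (f y')]
  congr 1
  rw [hre, him, hnat, hnat, hof, hof]
  ext v
  simp only [ContinuousAlternatingMap.add_apply, ContinuousAlternatingMap.smul_apply,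
    compContinuousLinearMap_apply]
  rfl

/-! #### The orientation is carried along near the centre -/

/-- **The frame carries `o y'` to `o x₀`, pointwise criterion.** At a point `z = e⁻¹ y` of the
chart source (with `y` in the target) where `U_z` is an isometry, if the sum of the chart volume
form `ν y = vol_{o z} ∘ D(e⁻¹)_y^{⊗n}` and of `μ y = vol_{o x₀} ∘ (M_f y)^{⊗n}` does not vanish on
some `n`-tuple `b`, then the isometry `φ = U_z : T_z M ≃ T_{x₀} M` carries `o z` to `o x₀`: otherwise
`U_z^* vol_{o x₀} = -vol_{o z}` (`volumeFormL_map_compContinuousLinearMap`, `volumeFormL_neg`),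
whose pull-back by `D(e⁻¹)_y` reads `μ y = -ν y`. [folklore] -/
theorem orientation_testFrame_of (hG : ∀ (x : M) (v w : TangentSpace 𝓘(ℝ, E) x), G x v w = ⟪v, w⟫)
    {y : E} (hy : y ∈ (e₀).target)
    (hiso : ∀ a b, G x₀ (Mf[e₀ ((e₀).symm y)] a) (Mf[e₀ ((e₀).symm y)] b) = Ĝ[e₀ ((e₀).symm y)] a b)
    (b : Fin n → E)
    (hb : MForm.inChart (riemannianVolumeForm o) x₀ y b +
      (o x₀).volumeFormL (fun i ↦ (Mf[y] (b i) : TangentSpace 𝓘(ℝ, E) x₀)) ≠ 0) :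
    ∃ φ : TangentSpace 𝓘(ℝ, E) ((e₀).symm y) ≃ₗᵢ[ℝ] TangentSpace 𝓘(ℝ, E) x₀,
      (∀ v, φ v = U[(e₀).symm y] v) ∧
        o x₀ = Orientation.map (Fin n) φ.toLinearEquiv (o ((e₀).symm y)) := by
  obtain ⟨φ, hφ⟩ := exists_linearIsometryEquiv_testFrame G S B x₀ hG ((e₀).map_target hy) hiso
  refine ⟨φ, hφ, ?_⟩
  by_contra hne
  have hneg : Orientation.map (Fin n) φ.toLinearEquiv (o ((e₀).symm y)) = -o x₀ :=
    (Orientation.eq_or_eq_neg (Orientation.map (Fin n) φ.toLinearEquiv (o ((e₀).symm y))) (o x₀)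
      (by simpa using (Fact.out : finrank ℝ (TangentSpace 𝓘(ℝ, E) x₀) = n).symm)).resolve_left
      (Ne.symm hne)
  -- `U_z^* vol_{o x₀} = -vol_{o z}` on `T_z M`
  have hvol := volumeFormL_map_compContinuousLinearMap (o ((e₀).symm y)) φ
  rw [hneg, Orientation.volumeFormL_neg] at hvol
  -- evaluate on the tuple `D(e⁻¹)_y b`
  have hev := congrArg (fun γ : TangentSpace 𝓘(ℝ, E) ((e₀).symm y) [⋀^Fin n]→L[ℝ] ℝ ↦
    γ (fun i ↦ mfderivWithin 𝓘(ℝ, E) 𝓘(ℝ, E) (e₀).symm (range 𝓘(ℝ, E)) y (b i))) hvol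
  simp only [compContinuousLinearMap_apply] at hev
  -- the arguments: `φ (D(e⁻¹)_y bᵢ) = M_f y bᵢ`
  have hMf : Mf[e₀ ((e₀).symm y)] = Mf[y] := by rw [(e₀).right_inv hy]
  have harg : ((φ : TangentSpace 𝓘(ℝ, E) ((e₀).symm y) →L[ℝ] TangentSpace 𝓘(ℝ, E) x₀) ∘
      fun i ↦ mfderivWithin 𝓘(ℝ, E) 𝓘(ℝ, E) (e₀).symm (range 𝓘(ℝ, E)) y (b i)) =
        fun i ↦ (Mf[y] (b i) : TangentSpace 𝓘(ℝ, E) x₀) := by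
    funext i
    exact (hφ _).trans ((congrArg (Mf[e₀ ((e₀).symm y)]) (chartDeriv_apply_symmDeriv x₀ hy (b i))).trans
      (congrArg (fun T : E →L[ℝ] E ↦ T (b i)) hMf))
  rw [harg] at hev
  -- `ν y b = vol_{o z} (D(e⁻¹)_y b)` by definition of the chart representative
  apply hb
  rw [MForm.inChart_apply, riemannianVolumeForm_apply, ← hev, ContinuousAlternatingMap.neg_apply,
    neg_add_cancel]

/-- **The frame carries `o y'` to `o x₀` for `y'` near `x₀`**, for a smooth metric and an
orientation family `o` whose volume form is smooth (`ho`), provided `M_f` is an isometry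
`Ĝ y → G x₀` for `y` near the centre (`hiso`, `eventually_frameM_isometry`), is `C^∞` at the centre
(`hMd`) and `M_f c = 1` (`hM1`, `frameM_apply_c`): the two volume forms `ν`, `μ` of
`orientation_testFrame_of` are continuous at `c` with the common value `vol_{o x₀} ≠ 0` there.
[folklore] -/
theorem eventually_orientation_testFrame
    (hG : ∀ (x : M) (v w : TangentSpace 𝓘(ℝ, E) x), G x v w = ⟪v, w⟫)
    (ho : IsSmoothForm (riemannianVolumeForm o))
    (hiso : ∀ᶠ y in 𝓝 c₀, ∀ a b, G x₀ (Mf[y] a) (Mf[y] b) = Ĝ[y] a b)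
    (hMd : ContDiffAt ℝ ∞ (fun y ↦ Mf[y]) c₀) (hM1 : Mf[c₀] = 1) :
    ∀ᶠ y' in 𝓝 x₀, ∃ φ : TangentSpace 𝓘(ℝ, E) y' ≃ₗᵢ[ℝ] TangentSpace 𝓘(ℝ, E) x₀,
      (∀ v, φ v = U[y'] v) ∧ o x₀ = Orientation.map (Fin n) φ.toLinearEquiv (o y') := by
  -- the test tuple: an orthonormal basis of `T_{x₀} M`
  set ob := stdOrthonormalBasisFin (TangentSpace 𝓘(ℝ, E) x₀) n with hob
  set b : Fin n → E := fun i ↦ (ob i : TangentSpace 𝓘(ℝ, E) x₀) with hbdef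
  -- the two volume forms evaluated on `b`, as functions of `y`
  set F : E → ℝ := fun y ↦ MForm.inChart (riemannianVolumeForm o) x₀ y b +
    (o x₀).volumeFormL (fun i ↦ (Mf[y] (b i) : TangentSpace 𝓘(ℝ, E) x₀)) with hF
  have hFc : ContinuousAt F c₀ := by
    have h1 : ContinuousAt (MForm.inChart (riemannianVolumeForm o) x₀) c₀ := by
      have := (ho x₀).continuousWithinAt
      rwa [ModelWithCorners.Boundaryless.range_eq_univ, continuousWithinAt_univ] at this
    have h2 : ContinuousAt (fun y ↦ ((o x₀).volumeFormL).compContinuousLinearMap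
        (Mf[y] : E →L[ℝ] TangentSpace 𝓘(ℝ, E) x₀)) c₀ :=
      (ContDiffAt.continuousAlternatingMapCompContinuousLinearMap contDiffAt_const hMd).continuousAt
    have h1' := ((continuous_eval_const b).tendsto _).comp h1
    have h2' := ((continuous_eval_const (fun i ↦ b i)).tendsto _).comp h2
    exact h1'.add h2'
  have hF0 : F c₀ ≠ 0 := by
    have hvol : (o x₀).volumeForm ob ≠ 0 := by
      have := (o x₀).abs_volumeForm_apply_of_orthonormal ob
      intro h0
      rw [h0, abs_zero] at this
      exact zero_ne_one this
    have h1 : MForm.inChart (riemannianVolumeForm o) x₀ c₀ b = (o x₀).volumeForm ob := by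
      rw [MForm.inChart_apply_self]
      rfl
    have h2 : (o x₀).volumeFormL (fun i ↦ (Mf[c₀] (b i) : TangentSpace 𝓘(ℝ, E) x₀)) =
        (o x₀).volumeForm ob := by
      rw [hM1]
      rfl
    have hval : F c₀ = 2 * (o x₀).volumeForm ob := by
      show MForm.inChart (riemannianVolumeForm o) x₀ c₀ b +
        (o x₀).volumeFormL (fun i ↦ (Mf[c₀] (b i) : TangentSpace 𝓘(ℝ, E) x₀)) = _
      rw [h1, h2, two_mul]
    rw [hval]
    exact mul_ne_zero two_ne_zero hvol
  have hFne : ∀ᶠ y in 𝓝 c₀, F y ≠ 0 := hFc.eventually_ne hF0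
  -- transport to `M`
  have htarget : ∀ᶠ y in 𝓝 c₀, y ∈ (e₀).target :=
    (isOpen_extChartAt_target (I := 𝓘(ℝ, E)) x₀).mem_nhds (mem_extChartAt_target x₀)
  have hE : ∀ᶠ y in 𝓝 c₀, ∃ φ : TangentSpace 𝓘(ℝ, E) ((e₀).symm y) ≃ₗᵢ[ℝ] TangentSpace 𝓘(ℝ, E) x₀,
      (∀ v, φ v = U[(e₀).symm y] v) ∧
        o x₀ = Orientation.map (Fin n) φ.toLinearEquiv (o ((e₀).symm y)) := by
    filter_upwards [hFne, htarget, hiso] with y hy1 hy2 hy3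
    have hy3' : ∀ a b, G x₀ (Mf[e₀ ((e₀).symm y)] a) (Mf[e₀ ((e₀).symm y)] b) =
        Ĝ[e₀ ((e₀).symm y)] a b := by
      rw [(e₀).right_inv hy2]
      exact hy3
    exact orientation_testFrame_of G S B x₀ o hG hy2 hy3' b hy1
  have hM' := (continuousAt_extChartAt (I := 𝓘(ℝ, E)) x₀).eventually hE
  filter_upwards [hM', extChartAt_source_mem_nhds (I := 𝓘(ℝ, E)) x₀] with y' hy' hsrc
  rwa [(e₀).left_inv hsrc] at hy'

/-! #### `P Θ = 0` at the centre -/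

set_option hygiene false in
/-- Voisin's operator `P = [∂̄*, L] - i∂` in positive degree. -/
local notation "KP[" G ", " o ", " h₁ ", " h₃ "]" β:max =>
  (dolbeaultBarAdjoint o h₁ (Lform[G] β) - Lform[G] (dolbeaultBarAdjoint o h₃ β) -
    Complex.I • dolbeault β)

set_option hygiene false in
/-- The same operator on `0`-forms. -/
local notation "KP₀[" G ", " o ", " h₁ "]" β:max =>
  (dolbeaultBarAdjoint o h₁ (Lform[G] β) - Complex.I • dolbeault β)

variable [IsManifold 𝓘(ℂ, E) ω M]

omit [FiniteDimensional ℂ E] [RiemannianBundle (fun x : M ↦ TangentSpace 𝓘(ℝ, E) x)] in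
set_option maxHeartbeats 800000 in
/-- `∂ Θ_{f,η} (x₀) = 0`: every type component of `Θ_{f,η}` is a test form near `x₀`
(`testForm_typeComponent`), and test forms have vanishing exterior derivative at `x₀`
(`mextDeriv_testForm_eq_zero`). [cite: Voisin2002, §6.1.1 Prop. 6.5] -/
theorem dolbeault_testForm_apply_eq_zero (f : M → ℝ) (hf : ∀ᶠ y' in 𝓝 x₀, f y' = 1)
    (η : E [⋀^Fin k]→L[ℝ] ℂ) (hB : ∀ u v, B u v = B v u) (hMd : HasFDerivAt (fun y ↦ Mf[y]) B c₀)
    (hM : ∀ᶠ y' in 𝓝 x₀, Mf[e₀ y'] * ((Complex.I • ContinuousLinearMap.id ℂ E).restrictScalars ℝ) =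
      ((Complex.I • ContinuousLinearMap.id ℂ E).restrictScalars ℝ) * Mf[e₀ y']) :
    dolbeault (Θ[f, η]) x₀ = 0 := by
  refine dolbeault_apply_eq_zero fun p q _ ↦ ?_
  have hev : ∀ᶠ y' in 𝓝 x₀, MForm.typeComponent p q (Θ[f, η]) y' = (Θ[f, typeProjAt p q η]) y' := by
    filter_upwards [hM, extChartAt_source_mem_nhds (I := 𝓘(ℝ, E)) x₀] with y' hy' hsrc
    exact testForm_typeComponent G S B x₀ f η p q hsrc hy'
  rw [mextDeriv_congr_of_eventuallyEq hev]
  exact mextDeriv_testForm_eq_zero G S B x₀ f hf _ hB hMd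

set_option maxHeartbeats 800000 in
/-- `∂̄* Θ_{f,η} (x₀) = 0`: `⋆Θ_{f,η}` is a test form near `x₀` (`cHodgeStar_testForm`), so are its
type components, and their exterior derivatives vanish at `x₀`. [cite: Voisin2002, §6.1.1 Prop. 6.5] -/
theorem dolbeaultBarAdjoint_testForm_apply_eq_zero {m : ℕ} (h : (k + 1) + m = n) (f : M → ℝ)
    (hf : ∀ᶠ y' in 𝓝 x₀, f y' = 1) (η : E [⋀^Fin (k + 1)]→L[ℝ] ℂ) (hB : ∀ u v, B u v = B v u)
    (hMd : HasFDerivAt (fun y ↦ Mf[y]) B c₀)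
    (hM : ∀ᶠ y' in 𝓝 x₀, Mf[e₀ y'] * ((Complex.I • ContinuousLinearMap.id ℂ E).restrictScalars ℝ) =
      ((Complex.I • ContinuousLinearMap.id ℂ E).restrictScalars ℝ) * Mf[e₀ y'])
    (hor : ∀ᶠ y' in 𝓝 x₀, ∃ φ : TangentSpace 𝓘(ℝ, E) y' ≃ₗᵢ[ℝ] TangentSpace 𝓘(ℝ, E) x₀,
      (∀ v, φ v = U[y'] v) ∧ o x₀ = Orientation.map (Fin n) φ.toLinearEquiv (o y')) :
    dolbeaultBarAdjoint o h (Θ[f, η]) x₀ = 0 := by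
  refine dolbeaultBarAdjoint_apply_eq_zero o h fun p q _ ↦ ?_
  have hstar : ∀ᶠ y' in 𝓝 x₀, MForm.cHodgeStar o h (Θ[f, η]) y' = (Θ[f, ⋆ℂ[o x₀, h] η]) y' := by
    filter_upwards [hor] with y' hy'
    obtain ⟨φ, hφ, hφo⟩ := hy'
    exact cHodgeStar_testForm G S B x₀ o h f η φ hφ hφo
  have hev : ∀ᶠ y' in 𝓝 x₀, MForm.typeComponent p q (MForm.cHodgeStar o h (Θ[f, η])) y' =
      (Θ[f, typeProjAt p q (⋆ℂ[o x₀, h] η)]) y' := by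
    filter_upwards [typeComponent_eventuallyEq p q hstar, hM,
      extChartAt_source_mem_nhds (I := 𝓘(ℝ, E)) x₀] with y' hy' hM' hsrc
    rw [hy']
    exact testForm_typeComponent G S B x₀ f _ p q hsrc hM'
  rw [mextDeriv_congr_of_eventuallyEq hev]
  exact mextDeriv_testForm_eq_zero G S B x₀ f hf _ hB hMd

set_option maxHeartbeats 800000 in
/-- **`P Θ_{f,η} (x₀) = 0` in positive degree**: with `LΘ_{f,η} = Θ_{f,L₀η}` near `x₀`
(`lform_testForm`) and locality of `∂̄*`, all three terms of
`P Θ = ∂̄*(LΘ) - L(∂̄*Θ) - i∂Θ` vanish at `x₀`. This is the sentence "in osculating coordinates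
the first-order parts vanish at the point" of Voisin's proof of Prop. 6.5.
[cite: Voisin2002, §6.1.1 Prop. 6.5, Lemma 6.6] -/
theorem kaehlerP_testForm_apply_eq_zero {m₁ m₃ : ℕ} (h₁ : (k + 1 + 1 + 1) + m₁ = n)
    (h₃ : (k + 1) + m₃ = n) (f : M → ℝ) (hf : ∀ᶠ y' in 𝓝 x₀, f y' = 1)
    (η : E [⋀^Fin (k + 1)]→L[ℝ] ℂ) (hB : ∀ u v, B u v = B v u)
    (hMd : HasFDerivAt (fun y ↦ Mf[y]) B c₀)
    (hiso : ∀ᶠ y' in 𝓝 x₀, ∀ a b, G x₀ (Mf[e₀ y'] a) (Mf[e₀ y'] b) = Ĝ[e₀ y'] a b)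
    (hM : ∀ᶠ y' in 𝓝 x₀, Mf[e₀ y'] * ((Complex.I • ContinuousLinearMap.id ℂ E).restrictScalars ℝ) =
      ((Complex.I • ContinuousLinearMap.id ℂ E).restrictScalars ℝ) * Mf[e₀ y'])
    (hor : ∀ᶠ y' in 𝓝 x₀, ∃ φ : TangentSpace 𝓘(ℝ, E) y' ≃ₗᵢ[ℝ] TangentSpace 𝓘(ℝ, E) x₀,
      (∀ v, φ v = U[y'] v) ∧ o x₀ = Orientation.map (Fin n) φ.toLinearEquiv (o y')) :
    (KP[G, o, h₁, h₃] Θ[f, η]) x₀ = 0 := by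
  -- `LΘ = Θ_{L₀ η}` near `x₀`, hence `∂̄*(LΘ)(x₀) = ∂̄*(Θ_{L₀η})(x₀) = 0`
  have hL : ∀ᶠ y' in 𝓝 x₀, (Lform[G] Θ[f, η]) y' = (Θ[f, LopE[G x₀] η]) y' := by
    filter_upwards [hiso, hM, extChartAt_source_mem_nhds (I := 𝓘(ℝ, E)) x₀] with y' h1 h2 hsrc
    exact lform_testForm G S B x₀ f η hsrc h1 h2
  have hA : dolbeaultBarAdjoint o h₁ (Lform[G] Θ[f, η]) x₀ = 0 := by
    rw [dolbeaultBarAdjoint_congr_of_eventuallyEq o h₁ hL]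
    exact dolbeaultBarAdjoint_testForm_apply_eq_zero G S B x₀ o h₁ f hf _ hB hMd hM hor
  have hBB : dolbeaultBarAdjoint o h₃ (Θ[f, η]) x₀ = 0 :=
    dolbeaultBarAdjoint_testForm_apply_eq_zero G S B x₀ o h₃ f hf η hB hMd hM hor
  have hC : dolbeault (Θ[f, η]) x₀ = 0 := dolbeault_testForm_apply_eq_zero G S B x₀ f hf η hB hMd hM
  have hL0 : (Lform[G] (dolbeaultBarAdjoint o h₃ (Θ[f, η]))) x₀ = 0 := by
    rw [lform_apply, hBB]
    exact lopT_zero x₀ (G x₀)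
  rw [Pi.sub_apply, Pi.sub_apply, Pi.smul_apply, hA, hL0, hC, smul_zero, sub_zero, sub_zero]

set_option maxHeartbeats 800000 in
/-- **`P₀ Θ_{f,η} (x₀) = 0` on `0`-forms.** [cite: Voisin2002, §6.1.1 Prop. 6.5, Lemma 6.6] -/
theorem kaehlerP_testForm_apply_eq_zero_zero {m₁ : ℕ} (h₁ : (0 + 1 + 1) + m₁ = n) (f : M → ℝ)
    (hf : ∀ᶠ y' in 𝓝 x₀, f y' = 1) (η : E [⋀^Fin 0]→L[ℝ] ℂ) (hB : ∀ u v, B u v = B v u)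
    (hMd : HasFDerivAt (fun y ↦ Mf[y]) B c₀)
    (hiso : ∀ᶠ y' in 𝓝 x₀, ∀ a b, G x₀ (Mf[e₀ y'] a) (Mf[e₀ y'] b) = Ĝ[e₀ y'] a b)
    (hM : ∀ᶠ y' in 𝓝 x₀, Mf[e₀ y'] * ((Complex.I • ContinuousLinearMap.id ℂ E).restrictScalars ℝ) =
      ((Complex.I • ContinuousLinearMap.id ℂ E).restrictScalars ℝ) * Mf[e₀ y'])
    (hor : ∀ᶠ y' in 𝓝 x₀, ∃ φ : TangentSpace 𝓘(ℝ, E) y' ≃ₗᵢ[ℝ] TangentSpace 𝓘(ℝ, E) x₀,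
      (∀ v, φ v = U[y'] v) ∧ o x₀ = Orientation.map (Fin n) φ.toLinearEquiv (o y')) :
    (KP₀[G, o, h₁] Θ[f, η]) x₀ = 0 := by
  have hL : ∀ᶠ y' in 𝓝 x₀, (Lform[G] Θ[f, η]) y' = (Θ[f, LopE[G x₀] η]) y' := by
    filter_upwards [hiso, hM, extChartAt_source_mem_nhds (I := 𝓘(ℝ, E)) x₀] with y' h1 h2 hsrc
    exact lform_testForm G S B x₀ f η hsrc h1 h2
  have hA : dolbeaultBarAdjoint o h₁ (Lform[G] Θ[f, η]) x₀ = 0 := by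
    rw [dolbeaultBarAdjoint_congr_of_eventuallyEq o h₁ hL]
    exact dolbeaultBarAdjoint_testForm_apply_eq_zero G S B x₀ o h₁ f hf _ hB hMd hM hor
  have hC : dolbeault (Θ[f, η]) x₀ = 0 := dolbeault_testForm_apply_eq_zero G S B x₀ f hf η hB hMd hM
  rw [Pi.sub_apply, Pi.smul_apply, hA, hC, smul_zero, sub_zero]

end Exchange

end Literature.Geometry.Kaehler
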